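import Mathlib
import HarnessLib
import Summits.HubbardSuperconductivity.HubbardSuperconductivity.Theorems.KLProgrammeKLRegimeEnginePairTransferMemberTowerMasses

/-!
# Route `KLProgramme` — ENGINE (stmt-HubbardSuperconductivity-20437 `KLRegimeEngineV17F2`), row (c) binder #8: the PLAIN member's resolvent-tower package `htower`
# FROM hsucc-SHAPED ROWS with ALL FIVE loop classes as LOCALISED VALUE ROWS — **`klmt_htower_family_values`**
# (cell gate-hubbard-kl, seat hubbard-kl-k3c1-p1 g26, technique «composed-map remainder propagation»; cure (β) of the self-located reading «(c)-IN-PH-BELOW-RESOLUTION»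
# on ★ PIN v18's binder #8 `hexLadMS` (memo `HOME/hubbard-kl-k3c1-p1/g26/LOCATED-C-IN-PH-BELOW-RESOLUTION.md`); sequel of `klmt_htower_family_sigma` (…MemberTowerSigma, g25))

WHY.  `klmt_htower_family_sigma` carried the two particle–hole classes as `M4² × MASS` (`hP/hQ := klmd_sum3/2_ite_mul_le`, masses ↦ «PH-PROFILE» envelopes): the budget row then
holds the sign-blind FLAT CORE `2048·15367·M4²` at every diagonal point `k′ = k` (transfer `0`), while row (c)'s slot there, `(KlamU)²·klEngGeo14.phGain (n+1) 0 ≤ (KlamU)²·(2⁵⁴ +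
2⁶⁰klTS)·2^{−(n+1)}` (`klEngGeo14_phGain_zero_le`, …EnginePhGainBelowResolution), DECAYS — no home from `n ≈ 36 + log₂(1+klTS)` on.  A mass cannot see the cancellation that
makes the particle–hole VALUE vanish below resolution; the registered CLASS-ROWS door `klmd_defect_le_rows_family` (…MemberDefectRowsFamily, g13) already states the two classes
as VALUE rows `hP`, `hQ` (kernels inside the loop sum, labels pinned to the loop line, norm outside).  So **`klmt_htower_family_values`**: the fourteen-conjunct `htower` (generic
`Tb`/`Bar`; = `klmt_htower_plain`'s conclusion) from h5g″'s FAMILY PINS and, per in-class `Qm`, the rows AT `j = n+1`: a priori along the slice · history a priori · (F)(i) model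
row + cap · smallness · **the five value rows `RH RP RQ RS RL`** (= the door's `hH hP hQ hS hL`, `t`-uniform) · consumer rows with `J = (Λd)(½RH + (βL²)⁻³(RP + RQ + 2RS)) + RL`
(the door's conclusion verbatim).  NO `M4`, NO envelope, NO two-shell regime kit.  Inside: `ρ := klRungProfile` by name (`klmf_integral_norm_rate_le_klRungProfile`,
`sum_klRungProfile_compl_le`, `hm7`); the resolved source integral from `klmd_defect_le_rows_family` at `j = n+1` pointwise in `t` + `klmt_integral_norm_le_of_forall`; (F)(i) via
`klmf_memberCurve_zero_eq`; `softSymbolCompl_self` bridge into `klmt_htower_plain`.  Plumbing + real analysis over landed doors; every row is a HYPOTHESIS of its owner (class #1 /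
(c) closer / k3c2-p2 / E1); nothing here asserts (c), any open row of 20437, K3, U₀, the window or superconductivity.  0 kit · 0 lit.
-/

noncomputable section

namespace Summit.HubbardSuperconductivity.HubbardSuperconductivity.Theorems.KLRegimeSplit

set_option linter.dupNamespace false -- summit = problem name (single-conjunct summit), D-0017

open Finset Matrix Set Literature.MathematicalPhysics.QuantumLattice Literature.Probability.LatticeModels GrassmannAlgebra
open Summit.HubbardSuperconductivity.HubbardSuperconductivity.Theorems.KLProgrammeLegKernels
open Summit.HubbardSuperconductivity.HubbardSuperconductivity.Theorems.TwoPointAssembly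
open Summit.HubbardSuperconductivity.HubbardSuperconductivity.Theorems.DispersionFlow
open Summit.HubbardSuperconductivity.HubbardSuperconductivity.Theorems.KLRegimeWick
open Summit.HubbardSuperconductivity.HubbardSuperconductivity.Theorems.EngineV8

variable (L M : ℕ) [NeZero L] [NeZero M]

set_option maxHeartbeats 3200000 in -- long pinning equations (h5g″'s hsucc pins) + fourteen-conjunct package; plumbing only
/-- **`klmt_htower_family_values`** — the `htower` package (keying `(n, n+1)`, generic bar `Tb` / slot `Bar`) of the PLAIN member from hsucc-shaped rows with all five loop
classes as localised VALUE rows (module docstring). -/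
theorem klmt_htower_family_values {β U μ : ℝ} {n N : ℕ} {m : ℝ} (hm : 0 ≤ m) (hm7 : 3 / 2 * m * 738288 ≤ 1 / 3) {Rn : RenConsts} {G : GeoConsts}
    (hK : FrameOK Rn U N μ (klFlowFrameU L M β U μ (n + 1))) (hβ : klBetaMin ≤ β) (hβL : β ≤ L) (hG : (2 : ℝ) ^ 19 ≤ G.bhi)
    (hZ : ∀ Λ ∈ Icc (klScale klE0 (n + 1)) (klScale klE0 n), hubbardEffPartitionFnCT L M β U μ 0 (klFlowFrameU L M β U μ (n + 1)) Λ ≠ 0)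
    (A A' : ℕ → TorusSite 2 L → ℝ → Matrix (TorusSite 2 L) (TorusSite 2 L) ℂ) (b b' : ℕ → TorusSite 2 L → ℝ → TorusSite 2 L → ℂ)
    (ρ : ℕ → TorusSite 2 L → TorusSite 2 L → ℝ) (V : ℕ → ℝ → (Fin 4 → HubbardFieldIdx L M) → ℂ) (V6 : ℕ → ℝ → (Fin 6 → HubbardFieldIdx L M) → ℂ)
    (Sg : ℕ → ℝ → FreqMomentum L M → Fin 2 → ℂ) (Hd : ℕ → ℝ → (Fin 4 → HubbardFieldIdx L M) → ℂ) (Φ : ℕ → ℝ → FreqMomentum L M → ℝ) (Wd : ℝ → FreqMomentum L M → ℝ)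
    (Br : ℕ → TorusSite 2 L → ℝ → TorusSite 2 L × MatsubaraIdx M → ℂ)
    (hAdef : A = fun j Qm t => Matrix.of fun k k' : TorusSite 2 L => if k ∈ klBall L μ 0 ∧ k' ∈ klBall L μ 0 then vertexFn L M β (gaussConv ℂ (softCovOf L M β μ (klFlowFrameU L M β U μ (n + 1)) (softSymbolCompl L M β μ (klFlowFrameU L M β U μ (n + 1)) (n + 1) j) + hubbardCovAboveCT L M β μ 0 (klFlowFrameU L M β U μ (n + 1)) (klScale klE0 (n + 1)) - hubbardCovAboveCT L M β μ 0 (klFlowFrameU L M β U μ (n + 1)) (klScale klE0 n + t * (klScale klE0 (n + 1) - klScale klE0 n))) (hubbardEffectiveActionCT L M β U μ 0 (klFlowFrameU L M β U μ (n + 1)) (klScale klE0 n + t * (klScale klE0 (n + 1) - klScale klE0 n)))) 4 ![(((omega0 M, k'), 0), 0), ((((omega0 M).rev, Qm - k'), 1), 0), ((((omega0 M).rev, Qm - k), 1), 1), (((omega0 M, k), 0), 1)] else 0)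
    (hA'def : A' = fun j Qm t => Matrix.of fun k k' : TorusSite 2 L => if k ∈ klBall L μ 0 ∧ k' ∈ klBall L μ 0 then (klScale klE0 (n + 1) - klScale klE0 n) • -((2 : ℂ)⁻¹ * vertexFn L M β (gaussConv ℂ (softCovOf L M β μ (klFlowFrameU L M β U μ (n + 1)) (softSymbolCompl L M β μ (klFlowFrameU L M β U μ (n + 1)) (n + 1) j) + hubbardCovAboveCT L M β μ 0 (klFlowFrameU L M β U μ (n + 1)) (klScale klE0 (n + 1)) - hubbardCovAboveCT L M β μ 0 (klFlowFrameU L M β U μ (n + 1)) (klScale klE0 n + t * (klScale klE0 (n + 1) - klScale klE0 n))) (grassmannDerivPairing ℂ (Matrix.of fun X Y : HubbardFieldIdx L M => deriv (fun Λ'' : ℝ => hubbardCovAboveCT L M β μ 0 (klFlowFrameU L M β U μ (n + 1)) Λ'' X Y) (klScale klE0 n + t * (klScale klE0 (n + 1) - klScale klE0 n))) (hubbardEffectiveActionCT L M β U μ 0 (klFlowFrameU L M β U μ (n + 1)) (klScale klE0 n + t * (klScale klE0 (n + 1) - klScale klE0 n))) (hubbardEffectiveActionCT L M β U μ 0 (klFlowFrameU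 L M β U μ (n + 1)) (klScale klE0 n + t * (klScale klE0 (n + 1) - klScale klE0 n))))) 4 ![(((omega0 M, k'), 0), 0), ((((omega0 M).rev, Qm - k'), 1), 0), ((((omega0 M).rev, Qm - k), 1), 1), (((omega0 M, k), 0), 1)]) else 0)
    (hbdef : b = fun j Qm t p => -((klBubbleMass L M β μ (klFlowFrameU L M β U μ (n + 1)) (fun k => (softSymbolCompl L M β μ (klFlowFrameU L M β U μ (n + 1)) (n + 1) j) k + (hubbardCutoffWeightCT L M β μ (klFlowFrameU L M β U μ (n + 1)) (klScale klE0 (n + 1)) k - hubbardCutoffWeightCT L M β μ (klFlowFrameU L M β U μ (n + 1)) (klScale klE0 n + t * (klScale klE0 (n + 1) - klScale klE0 n)) k)) (fun k => (softSymbolCompl L M β μ (klFlowFrameU L M β U μ (n + 1)) (n + 1) j) k + (hubbardCutoffWeightCT L M β μ (klFlowFrameU L M β U μ (n + 1)) (klScale klE0 (n + 1)) k - hubbardCutoffWeightCT L M β μ (klFlowFrameU L M β U μ (n + 1)) (klScale klE0 n + t * (klScale klE0 (n + 1) - klScale klE0 n)) k)) Qm p : ℝ) : ℂ))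
    (hb'def : b' = fun j Qm t p => (((klScale klE0 (n + 1) - klScale klE0 n) * (klBubbleMass L M β μ (klFlowFrameU L M β U μ (n + 1)) (fun k => deriv (fun Λ' => hubbardCutoffWeightCT L M β μ (klFlowFrameU L M β U μ (n + 1)) Λ' k) (klScale klE0 n + t * (klScale klE0 (n + 1) - klScale klE0 n))) (fun k => (softSymbolCompl L M β μ (klFlowFrameU L M β U μ (n + 1)) (n + 1) j) k + (hubbardCutoffWeightCT L M β μ (klFlowFrameU L M β U μ (n + 1)) (klScale klE0 (n + 1)) k - hubbardCutoffWeightCT L M β μ (klFlowFrameU L M β U μ (n + 1)) (klScale klE0 n + t * (klScale klE0 (n + 1) - klScale klE0 n)) k)) Qm p + klBubbleMass L M β μ (klFlowFrameU L M β U μ (n + 1)) (fun k => (softSymbolCompl L M β μ (klFlowFrameU L M β U μ (n + 1)) (n + 1) j) k + (hubbardCutoffWeightCT L M β μ (klFlowFrameU L M β U μ (n + 1)) (klScale klE0 (n + 1)) k - hubbardCutoffWeightCT L M β μ (klFlowFrameU L M β U μ (n + 1)) (klScale klE0 n + t * (klScale klE0 (n + 1) - klScale klE0 n)) k)) (fun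 k => deriv (fun Λ' => hubbardCutoffWeightCT L M β μ (klFlowFrameU L M β U μ (n + 1)) Λ' k) (klScale klE0 n + t * (klScale klE0 (n + 1) - klScale klE0 n))) Qm p) : ℝ) : ℂ))
    (hρdef : ρ = fun j Qm c => klRungProfile L M β μ (klFlowFrameU L M β U μ (n + 1)) n (softSymbolCompl L M β μ (klFlowFrameU L M β U μ (n + 1)) (n + 1) j) Qm c)
    (hV : V = fun j t X => vertexFn L M β (gaussConv ℂ (softCovOf L M β μ (klFlowFrameU L M β U μ (n + 1)) (softSymbolCompl L M β μ (klFlowFrameU L M β U μ (n + 1)) (n + 1) j) + hubbardCovAboveCT L M β μ 0 (klFlowFrameU L M β U μ (n + 1)) (klScale klE0 (n + 1)) - hubbardCovAboveCT L M β μ 0 (klFlowFrameU L M β U μ (n + 1)) (klScale klE0 n + t * (klScale klE0 (n + 1) - klScale klE0 n))) (hubbardEffectiveActionCT L M β U μ 0 (klFlowFrameU L M β U μ (n + 1)) (klScale klE0 n + t * (klScale klE0 (n + 1) - klScale klE0 n)))) 4 X)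
    (hV6 : V6 = fun j t X => vertexFn L M β (gaussConv ℂ (softCovOf L M β μ (klFlowFrameU L M β U μ (n + 1)) (softSymbolCompl L M β μ (klFlowFrameU L M β U μ (n + 1)) (n + 1) j) + hubbardCovAboveCT L M β μ 0 (klFlowFrameU L M β U μ (n + 1)) (klScale klE0 (n + 1)) - hubbardCovAboveCT L M β μ 0 (klFlowFrameU L M β U μ (n + 1)) (klScale klE0 n + t * (klScale klE0 (n + 1) - klScale klE0 n))) (hubbardEffectiveActionCT L M β U μ 0 (klFlowFrameU L M β U μ (n + 1)) (klScale klE0 n + t * (klScale klE0 (n + 1) - klScale klE0 n)))) 6 X)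
    (hSg : Sg = fun j t p σ => selfEnergy L M β (gaussConv ℂ (softCovOf L M β μ (klFlowFrameU L M β U μ (n + 1)) (softSymbolCompl L M β μ (klFlowFrameU L M β U μ (n + 1)) (n + 1) j) + hubbardCovAboveCT L M β μ 0 (klFlowFrameU L M β U μ (n + 1)) (klScale klE0 (n + 1)) - hubbardCovAboveCT L M β μ 0 (klFlowFrameU L M β U μ (n + 1)) (klScale klE0 n + t * (klScale klE0 (n + 1) - klScale klE0 n))) (hubbardEffectiveActionCT L M β U μ 0 (klFlowFrameU L M β U μ (n + 1)) (klScale klE0 n + t * (klScale klE0 (n + 1) - klScale klE0 n)))) p σ)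
    (hHd : Hd = fun j t X => vertexFn L M β (dblFold ℂ (grassmannLaplacian ℂ (crossCov ℂ (Matrix.of fun X Y : HubbardFieldIdx L M => deriv (fun Λ' : ℝ => hubbardCovAboveCT L M β μ 0 (klFlowFrameU L M β U μ (n + 1)) Λ' X Y) (klScale klE0 n + t * (klScale klE0 (n + 1) - klScale klE0 n)))) ((gaussConv ℂ (crossCov ℂ (softCovOf L M β μ (klFlowFrameU L M β U μ (n + 1)) (softSymbolCompl L M β μ (klFlowFrameU L M β U μ (n + 1)) (n + 1) j) + hubbardCovAboveCT L M β μ 0 (klFlowFrameU L M β U μ (n + 1)) (klScale klE0 (n + 1)) - hubbardCovAboveCT L M β μ 0 (klFlowFrameU L M β U μ (n + 1)) (klScale klE0 n + t * (klScale klE0 (n + 1) - klScale klE0 n)))) - grassmannLaplacian ℂ (crossCov ℂ (softCovOf L M β μ (klFlowFrameU L M β U μ (n + 1)) (softSymbolCompl L M β μ (klFlowFrameU L M β U μ (n + 1)) (n + 1) j) + hubbardCovAboveCT L M β μ 0 (klFlowFrameU L M β U μ (n + 1)) (klScale klE0 (n + 1)) - hubbardCovAboveCT L M β μ 0 (klFlowFrameU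 L M β U μ (n + 1)) (klScale klE0 n + t * (klScale klE0 (n + 1) - klScale klE0 n))))) (dblCopy ℂ 0 (gaussConv ℂ (softCovOf L M β μ (klFlowFrameU L M β U μ (n + 1)) (softSymbolCompl L M β μ (klFlowFrameU L M β U μ (n + 1)) (n + 1) j) + hubbardCovAboveCT L M β μ 0 (klFlowFrameU L M β U μ (n + 1)) (klScale klE0 (n + 1)) - hubbardCovAboveCT L M β μ 0 (klFlowFrameU L M β U μ (n + 1)) (klScale klE0 n + t * (klScale klE0 (n + 1) - klScale klE0 n))) (hubbardEffectiveActionCT L M β U μ 0 (klFlowFrameU L M β U μ (n + 1)) (klScale klE0 n + t * (klScale klE0 (n + 1) - klScale klE0 n)))) * dblCopy ℂ 1 (gaussConv ℂ (softCovOf L M β μ (klFlowFrameU L M β U μ (n + 1)) (softSymbolCompl L M β μ (klFlowFrameU L M β U μ (n + 1)) (n + 1) j) + hubbardCovAboveCT L M β μ 0 (klFlowFrameU L M β U μ (n + 1)) (klScale klE0 (n + 1)) - hubbardCovAboveCT L M β μ 0 (klFlowFrameU L M β U μ (n + 1)) (klScale klE0 n + t * (klScale klE0 (n + 1) - klScale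 klE0 n))) (hubbardEffectiveActionCT L M β U μ 0 (klFlowFrameU L M β U μ (n + 1)) (klScale klE0 n + t * (klScale klE0 (n + 1) - klScale klE0 n)))))))) 4 X)
    (hΦ : Φ = fun j t k => (softSymbolCompl L M β μ (klFlowFrameU L M β U μ (n + 1)) (n + 1) j) k + (hubbardCutoffWeightCT L M β μ (klFlowFrameU L M β U μ (n + 1)) (klScale klE0 (n + 1)) k - hubbardCutoffWeightCT L M β μ (klFlowFrameU L M β U μ (n + 1)) (klScale klE0 n + t * (klScale klE0 (n + 1) - klScale klE0 n)) k))
    (hWd : Wd = fun t k => deriv (fun Λ' : ℝ => hubbardCutoffWeightCT L M β μ (klFlowFrameU L M β U μ (n + 1)) Λ' k) (klScale klE0 n + t * (klScale klE0 (n + 1) - klScale klE0 n)))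
    (hBr : Br = fun j Qm t z => -(((((β * (L : ℝ) ^ 2 : ℝ) : ℂ)))⁻¹ * propCT L M β μ (klFlowFrameU L M β U μ (n + 1)) (z.2, z.1) * propCT L M β μ (klFlowFrameU L M β U μ (n + 1)) (z.2.rev, Qm - z.1)) * ((((klScale klE0 (n + 1) - klScale klE0 n) * (-Wd t (z.2, z.1) * Φ j t (z.2.rev, Qm - z.1) - Φ j t (z.2, z.1) * Wd t (z.2.rev, Qm - z.1))) : ℝ) : ℂ))
    (Tb Bar : TorusSite 2 L → TorusSite 2 L → TorusSite 2 L → ℝ)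
    (hrows : ∀ Qm : TorusSite 2 L, IsPairClassAt L Qm (n + 1) →
      ∃ (r' e₁ : ℝ) (η E₁ RH RP RQ RS RL : TorusSite 2 L → TorusSite 2 L → ℝ), 0 ≤ r' ∧ 0 ≤ e₁ ∧
        -- a priori along the slice; history a priori [class #1]
        (∀ t ∈ Icc (0 : ℝ) 1, ∀ x y, ‖A (n + 1) Qm t x y‖ ≤ m) ∧
        (∀ x y, ‖klMemberArrayF L M β U μ n (softSymbolCompl L M β μ (klFlowFrameU L M β U μ n) n (n + 1)) Qm x y‖ ≤ m) ∧
        -- (F)(i): majorant of the FRAME SHIFT `K_n → K_(n+1)` of the history member (model objects) + its scalar cap [k3c2-p2]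
        (∀ x y, ‖((Matrix.of fun k k' : TorusSite 2 L => if k ∈ klBall L μ 0 ∧ k' ∈ klBall L μ 0 then klCovSmearedPairAmplitude L M β U μ (klFlowFrameU L M β U μ (n + 1)) n (softCovOf L M β μ (klFlowFrameU L M β U μ (n + 1)) (softSymbolCompl L M β μ (klFlowFrameU L M β U μ (n + 1)) n (n + 1))) Qm k k' else 0) - klMemberArrayF L M β U μ n (softSymbolCompl L M β μ (klFlowFrameU L M β U μ n) n (n + 1)) Qm) x y‖ ≤ η x y) ∧ (∀ x y, η x y ≤ r') ∧
        -- smallness of the NAMED tower weight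
        (3 / 2 * m + r') * ∑ p, |klSliceWeightSmeared L M β μ (klFlowFrameU L M β U μ (n + 1)) (n + 1) (fun _ => (0 : ℝ)) Qm p| ≤ 1 / 3 ∧
        -- the FIVE loop classes of the resolved source AS LOCALISED VALUE ROWS (`klmd_defect_le_rows_family`'s own hypotheses at `j = n+1`, kernels INSIDE the loop sums,
        -- norm outside; NO kernel sup, NO weight mass): «≥ 2 cross lines» `RH`, particle–hole direct `RP`, particle–hole exchange `RQ`, the 6–2 / born Σ-triple `RS`, localisation `RL`
        (∀ t ∈ Icc (0 : ℝ) 1, ∀ x y : TorusSite 2 L, ‖Hd (n + 1) t ![(((omega0 M, y), 0), 0), ((((omega0 M).rev, Qm - y), 1), 0), ((((omega0 M).rev, Qm - x), 1), 1), (((omega0 M, x), 0), 1)]‖ ≤ RH x y) ∧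
        (∀ t ∈ Icc (0 : ℝ) 1, ∀ x y : TorusSite 2 L, ‖(∑ p : FreqMomentum L M, ∑ σ : Fin 2, ∑ p' : FreqMomentum L M, if matsubaraInt M p'.1 + matsubaraInt M (omega0 M) = matsubaraInt M p.1 + matsubaraInt M (omega0 M) ∧ p'.2 = p.2 + x - y then ((((((Φ (n + 1) t p) : ℝ) : ℂ) * (((β * (L : ℝ) ^ 2 : ℝ) : ℂ) * propCT L M β μ (klFlowFrameU L M β U μ (n + 1)) p)) * ((((Wd t p') : ℝ) : ℂ) * (((β * (L : ℝ) ^ 2 : ℝ) : ℂ) * propCT L M β μ (klFlowFrameU L M β U μ (n + 1)) p'))) + (((((Wd t p) : ℝ) : ℂ) * (((β * (L : ℝ) ^ 2 : ℝ) : ℂ) * propCT L M β μ (klFlowFrameU L M β U μ (n + 1)) p)) * ((((Φ (n + 1) t p') : ℝ) : ℂ) * (((β * (L : ℝ) ^ 2 : ℝ) : ℂ) * propCT L M β μ (klFlowFrameU L M β U μ (n + 1)) p')))) * (V (n + 1) t ![((p, σ), 1), ((p', σ), 0), (((omega0 M, y), 0), 0), (((omega0 M, x), 0), 1)] * V (n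 + 1) t ![((p, σ), 0), ((p', σ), 1), ((((omega0 M).rev, Qm - y), 1), 0), ((((omega0 M).rev, Qm - x), 1), 1)]) else 0)‖ ≤ RP x y) ∧
        (∀ t ∈ Icc (0 : ℝ) 1, ∀ x y : TorusSite 2 L, ‖(∑ p : FreqMomentum L M, ∑ p' : FreqMomentum L M, if matsubaraInt M p'.1 + matsubaraInt M (omega0 M) + matsubaraInt M (omega0 M) + 1 = matsubaraInt M p.1 ∧ p'.2 = p.2 + Qm - x - y then ((((((Φ (n + 1) t p) : ℝ) : ℂ) * (((β * (L : ℝ) ^ 2 : ℝ) : ℂ) * propCT L M β μ (klFlowFrameU L M β U μ (n + 1)) p)) * ((((Wd t p') : ℝ) : ℂ) * (((β * (L : ℝ) ^ 2 : ℝ) : ℂ) * propCT L M β μ (klFlowFrameU L M β U μ (n + 1)) p'))) + (((((Wd t p) : ℝ) : ℂ) * (((β * (L : ℝ) ^ 2 : ℝ) : ℂ) * propCT L M β μ (klFlowFrameU L M β U μ (n + 1)) p)) * ((((Φ (n + 1) t p') : ℝ) : ℂ) * (((β * (L : ℝ) ^ 2 : ℝ) : ℂ) * propCT L M β μ (klFlowFrameU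 L M β U μ (n + 1)) p')))) * (V (n + 1) t ![((p, 0), 1), ((p', 1), 0), (((omega0 M, y), 0), 0), ((((omega0 M).rev, Qm - x), 1), 1)] * V (n + 1) t ![((p, 0), 0), ((p', 1), 1), ((((omega0 M).rev, Qm - y), 1), 0), (((omega0 M, x), 0), 1)]) else 0)‖ ≤ RQ x y) ∧
        (∀ t ∈ Icc (0 : ℝ) 1, ∀ x y : TorusSite 2 L, ‖(∑ p : FreqMomentum L M, ∑ σ : Fin 2, (((((Wd t p) : ℝ) : ℂ) * (((β * (L : ℝ) ^ 2 : ℝ) : ℂ) * propCT L M β μ (klFlowFrameU L M β U μ (n + 1)) p)) * ((((Φ (n + 1) t p) : ℝ) : ℂ) * (((β * (L : ℝ) ^ 2 : ℝ) : ℂ) * propCT L M β μ (klFlowFrameU L M β U μ (n + 1)) p))) * (V6 (n + 1) t ![((p, σ), 0), ((p, σ), 1), (((omega0 M, y), 0), 0), ((((omega0 M).rev, Qm - y), 1), 0), ((((omega0 M).rev, Qm - x), 1), 1), (((omega0 M, x), 0), 1)] * Sg (n + 1) t p σ))‖ ≤ RS x y) ∧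
        (∀ t ∈ Icc (0 : ℝ) 1, ∀ x y : TorusSite 2 L, ‖∑ z : TorusSite 2 L × MatsubaraIdx M, Br (n + 1) Qm t z * ((if z.1 ∈ klBall L μ 0 then V (n + 1) t ![(((omega0 M, z.1), 0), 0), ((((omega0 M).rev, Qm - z.1), 1), 0), ((((omega0 M).rev, Qm - x), 1), 1), (((omega0 M, x), 0), 1)] * V (n + 1) t ![(((omega0 M, y), 0), 0), ((((omega0 M).rev, Qm - y), 1), 0), ((((omega0 M).rev, Qm - z.1), 1), 1), (((omega0 M, z.1), 0), 1)] else 0) - V (n + 1) t ![(((z.2, z.1), 0), 0), (((z.2.rev, Qm - z.1), 1), 0), ((((omega0 M).rev, Qm - x), 1), 1), (((omega0 M, x), 0), 1)] * V (n + 1) t ![(((omega0 M, y), 0), 0), ((((omega0 M).rev, Qm - y), 1), 0), (((z.2.rev, Qm - z.1), 1), 1), (((z.2, z.1), 0), 1)])‖ ≤ RL x y) ∧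
        -- consumer-side rows at the bar `Tb Qm` and the slot `Bar Qm`; the source majorant `FT_ρ[J] + FT_w[η]` WRITTEN OUT with `J = (Λd)(½RH + (βL²)⁻³(RP + RQ + 2RS)) + RL`
        (∀ x y, Tb Qm x y ≤ r') ∧
        (∀ x y, ((((klScale klE0 n - klScale klE0 (n + 1)) * (2⁻¹ * RH x y + ((β * (L : ℝ) ^ 2) ^ 3)⁻¹ * (RP x y + RQ x y + 2 * RS x y)) + RL x y) + 3 / 2 * (3 / 2 * m) * ∑ c, ((klScale klE0 n - klScale klE0 (n + 1)) * (2⁻¹ * RH x c + ((β * (L : ℝ) ^ 2) ^ 3)⁻¹ * (RP x c + RQ x c + 2 * RS x c)) + RL x c) * ρ (n + 1) Qm c + 3 / 2 * m * ∑ a, ρ (n + 1) Qm a * ((klScale klE0 n - klScale klE0 (n + 1)) * (2⁻¹ * RH a y + ((β * (L : ℝ) ^ 2) ^ 3)⁻¹ * (RP a y + RQ a y + 2 * RS a y)) + RL a y) + 9 / 4 * m * (3 / 2 * m) * ∑ a, ∑ c, ρ (n + 1) Qm a * ((klScale klE0 n - klScale klE0 (n + 1)) * (2⁻¹ * RH a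 c + ((β * (L : ℝ) ^ 2) ^ 3)⁻¹ * (RP a c + RQ a c + 2 * RS a c)) + RL a c) * ρ (n + 1) Qm c) +
            (η x y + 3 / 2 * (3 / 2 * m) * ∑ t, η x t * |klSliceWeightSmeared L M β μ (klFlowFrameU L M β U μ (n + 1)) (n + 1) (fun _ => (0 : ℝ)) Qm t| + 3 / 2 * (3 / 2 * m + r') * ∑ a, |klSliceWeightSmeared L M β μ (klFlowFrameU L M β U μ (n + 1)) (n + 1) (fun _ => (0 : ℝ)) Qm a| * η a y + 9 / 4 * (3 / 2 * m + r') * (3 / 2 * m) * ∑ a, ∑ t, |klSliceWeightSmeared L M β μ (klFlowFrameU L M β U μ (n + 1)) (n + 1) (fun _ => (0 : ℝ)) Qm a| * η a t * |klSliceWeightSmeared L M β μ (klFlowFrameU L M β U μ (n + 1)) (n + 1) (fun _ => (0 : ℝ)) Qm t|)) +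
          (Tb Qm x y + 3 / 2 * (3 / 2 * m) * ∑ t, Tb Qm x t * |klSliceWeightSmeared L M β μ (klFlowFrameU L M β U μ (n + 1)) (n + 1) (fun _ => (0 : ℝ)) Qm t| + 3 / 2 * (3 / 2 * m + r') * ∑ a, |klSliceWeightSmeared L M β μ (klFlowFrameU L M β U μ (n + 1)) (n + 1) (fun _ => (0 : ℝ)) Qm a| * Tb Qm a y + 9 / 4 * (3 / 2 * m + r') * (3 / 2 * m) * ∑ a, ∑ t, |klSliceWeightSmeared L M β μ (klFlowFrameU L M β U μ (n + 1)) (n + 1) (fun _ => (0 : ℝ)) Qm a| * Tb Qm a t * |klSliceWeightSmeared L M β μ (klFlowFrameU L M β U μ (n + 1)) (n + 1) (fun _ => (0 : ℝ)) Qm t|) ≤ E₁ x y) ∧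
        (∀ x y, E₁ x y ≤ e₁) ∧
        (∀ k ∈ klBall L μ 0, ∀ k' ∈ klBall L μ 0, E₁ k k' ≤ Bar Qm k k')) :
    ∀ Qm : TorusSite 2 L, IsPairClassAt L Qm (n + 1) →
      ∃ (X Nm : Matrix (TorusSite 2 L) (TorusSite 2 L) ℂ) (w₁ : TorusSite 2 L → ℝ) (Ea E₁ : TorusSite 2 L → TorusSite 2 L → ℝ) (r' e₁ : ℝ),
        0 ≤ r' ∧ 0 ≤ e₁ ∧
        (∀ x y, ¬(x ∈ klBall L μ 0 ∧ y ∈ klBall L μ 0) → X x y = 0) ∧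
        (∀ k ∈ klBall L μ 0, ∀ k' ∈ klBall L μ 0,
          X k k' = klCovSmearedPairAmplitude L M β U μ (klFlowFrameU L M β U μ n) n
            (softCovOf L M β μ (klFlowFrameU L M β U μ n) (softSymbolCompl L M β μ (klFlowFrameU L M β U μ n) n (n + 1))) Qm k k') ∧
        (∀ x y, 0 ≤ Ea x y) ∧
        (1 + Matrix.diagonal (fun p => (w₁ p : ℂ)) * X) * Nm = 1 ∧
        (∀ k ∈ klBall L μ 0, ∀ k' ∈ klBall L μ 0, ‖klPairArrayF L M β U μ (n + 1) Qm k k' - (X * Nm) k k'‖ ≤ Ea k k') ∧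
        (∀ x y, Tb Qm x y ≤ r') ∧
        (∀ x y, Ea x y + (Tb Qm x y + 3 / 2 * (3 / 2 * m) * ∑ t, Tb Qm x t * |w₁ t| + 3 / 2 * (3 / 2 * m + r') * ∑ a, |w₁ a| * Tb Qm a y +
            9 / 4 * (3 / 2 * m + r') * (3 / 2 * m) * ∑ a, ∑ t, |w₁ a| * Tb Qm a t * |w₁ t|) ≤ E₁ x y) ∧
        (∀ x y, E₁ x y ≤ e₁) ∧
        (3 / 2 * m + r') * ∑ a, |w₁ a| ≤ 1 / 3 ∧
        (∑ p, |w₁ p| ≤ 3 / 4 * G.bhi) ∧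
        (∑ p, (|w₁ p| - w₁ p) ≤ klEdge G (n + 1) (klTorusNorm L Qm)) ∧
        (∀ k ∈ klBall L μ 0, ∀ k' ∈ klBall L μ 0, E₁ k k' ≤ Bar Qm k k')  := by
  have hβ0 : 0 < β := pos_of_klBetaMin_le hβ
  -- the family member `j = n+1` IS the plain member
  have hs0 : softSymbolCompl L M β μ (klFlowFrameU L M β U μ (n + 1)) (n + 1) (n + 1) = fun _ => (0 : ℝ) := softSymbolCompl_self β μ _ (n + 1)
  -- the door's rows speak the PINNED symbols `Φ`, `Wd`
  subst hΦ hWd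
  refine klmt_htower_plain L M hm hK hβ hβL hG hZ (A (n + 1)) (A' (n + 1)) (b (n + 1)) (b' (n + 1))
    (by rw [hAdef]; simp only [hs0]) (by rw [hA'def]; simp only [hs0]) (by rw [hbdef]; simp only [hs0]) (by rw [hb'def]; simp only [hs0]) Tb Bar ?_
  intro Qm hQm
  obtain ⟨r', e₁, η, E₁, RH, RP, RQ, RS, RL, hr', he₁, hAm, hXm, hη, hηe, hsm₁, hRH, hRP, hRQ, hRS, hRL, hTb, hE₁, hE₁e, hbar⟩ := hrows Qm hQm
  clear hrows
  -- (F)(i): the start of the member curve is the re-framed history member (model object)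
  have hA0 := klmf_memberCurve_zero_eq L M hZ A A' hAdef hA'def (n + 1) Qm
  have hη' : ∀ x y, ‖(A (n + 1) Qm 0 - klMemberArrayF L M β U μ n (softSymbolCompl L M β μ (klFlowFrameU L M β U μ n) n (n + 1)) Qm) x y‖ ≤ η x y := by
    rw [hA0]; exact hη
  have hη0 : ∀ x y, 0 ≤ η x y := fun x y => (norm_nonneg _).trans (hη x y)
  -- the rate profile BY NAME and its total mass
  have hψ0 : ∀ k, 0 ≤ softSymbolCompl L M β μ (klFlowFrameU L M β U μ (n + 1)) (n + 1) (n + 1) k := fun k => by rw [hs0]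
  have hVρ : ∀ c, (∫ τ in (0 : ℝ)..1, ‖b' (n + 1) Qm τ c‖) ≤ ρ (n + 1) Qm c := fun c => by
    rw [hρdef]; beta_reduce
    exact klmf_integral_norm_rate_le_klRungProfile β μ (klFlowFrameU L M β U μ (n + 1)) hβ0 n hψ0 Qm c (fun t p => b' (n + 1) Qm t p) (by rw [hb'def])
  have hsm : 3 / 2 * m * ∑ c, ρ (n + 1) Qm c ≤ 1 / 3 := by
    have h := sum_klRungProfile_compl_le (M := M) β μ (klFlowFrameU L M β U μ (n + 1)) hK hβ hβL (le_refl (n + 1)) Qm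
    rw [hρdef]; beta_reduce
    have h3 : 0 ≤ 3 / 2 * m := by positivity
    exact (mul_le_mul_of_nonneg_left h h3).trans hm7
  -- the RESOLVED source, pointwise in `t`, through the CLASS-ROWS door with all five classes as rows
  have hpt : ∀ t ∈ Icc (0 : ℝ) 1, ∀ x y,
      ‖(A' (n + 1) Qm t + A (n + 1) Qm t * diagonal (b' (n + 1) Qm t) * A (n + 1) Qm t) x y‖ ≤ ((klScale klE0 n - klScale klE0 (n + 1)) * (2⁻¹ * RH x y + ((β * (L : ℝ) ^ 2) ^ 3)⁻¹ * (RP x y + RQ x y + 2 * RS x y)) + RL x y) := fun t ht x y =>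
    klmd_defect_le_rows_family L M β U μ (klFlowFrameU L M β U μ (n + 1)) hβ0 n A A' b' hAdef hA'def hb'def V hV V6 hV6 Sg hSg Hd hHd _ rfl _ rfl
      Br hBr (n + 1) Qm ht x y (hRH t ht x y) (hRP t ht x y) (hRQ t ht x y) (hRS t ht x y) (hRL t ht x y)
  have hI : ∀ x y, (∫ t in (0 : ℝ)..1, ‖(A' (n + 1) Qm t + A (n + 1) Qm t * diagonal (b' (n + 1) Qm t) * A (n + 1) Qm t) x y‖) ≤ ((klScale klE0 n - klScale klE0 (n + 1)) * (2⁻¹ * RH x y + ((β * (L : ℝ) ^ 2) ^ 3)⁻¹ * (RP x y + RQ x y + 2 * RS x y)) + RL x y) :=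
    fun x y => klmt_integral_norm_le_of_forall fun t ht => hpt t ht x y
  exact ⟨r', e₁, ρ (n + 1) Qm, η, fun x y => ((klScale klE0 n - klScale klE0 (n + 1)) * (2⁻¹ * RH x y + ((β * (L : ℝ) ^ 2) ^ 3)⁻¹ * (RP x y + RQ x y + 2 * RS x y)) + RL x y),
    fun x y => (((klScale klE0 n - klScale klE0 (n + 1)) * (2⁻¹ * RH x y + ((β * (L : ℝ) ^ 2) ^ 3)⁻¹ * (RP x y + RQ x y + 2 * RS x y)) + RL x y) + 3 / 2 * (3 / 2 * m) * ∑ c, ((klScale klE0 n - klScale klE0 (n + 1)) * (2⁻¹ * RH x c + ((β * (L : ℝ) ^ 2) ^ 3)⁻¹ * (RP x c + RQ x c + 2 * RS x c)) + RL x c) * ρ (n + 1) Qm c + 3 / 2 * m * ∑ a, ρ (n + 1) Qm a * ((klScale klE0 n - klScale klE0 (n + 1)) * (2⁻¹ * RH a y + ((β * (L : ℝ) ^ 2) ^ 3)⁻¹ * (RP a y + RQ a y + 2 * RS a y)) + RL a y) + 9 / 4 * m * (3 / 2 * m) * ∑ a, ∑ c, ρ (n + 1) Qm a * ((klScale klE0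 n - klScale klE0 (n + 1)) * (2⁻¹ * RH a c + ((β * (L : ℝ) ^ 2) ^ 3)⁻¹ * (RP a c + RQ a c + 2 * RS a c)) + RL a c) * ρ (n + 1) Qm c) +
            (η x y + 3 / 2 * (3 / 2 * m) * ∑ t, η x t * |klSliceWeightSmeared L M β μ (klFlowFrameU L M β U μ (n + 1)) (n + 1) (fun _ => (0 : ℝ)) Qm t| + 3 / 2 * (3 / 2 * m + r') * ∑ a, |klSliceWeightSmeared L M β μ (klFlowFrameU L M β U μ (n + 1)) (n + 1) (fun _ => (0 : ℝ)) Qm a| * η a y + 9 / 4 * (3 / 2 * m + r') * (3 / 2 * m) * ∑ a, ∑ t, |klSliceWeightSmeared L M β μ (klFlowFrameU L M β U μ (n + 1)) (n + 1) (fun _ => (0 : ℝ)) Qm a| * η a t * |klSliceWeightSmeared L M β μ (klFlowFrameU L M β U μ (n + 1)) (n + 1) (fun _ => (0 : ℝ)) Qm t|),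
    E₁, hr', he₁, hAm, hVρ, hsm, hXm, hη0, hη', hηe, hsm₁, hI, fun x y => le_rfl, hTb, hE₁, hE₁e, hbar⟩

end Summit.HubbardSuperconductivity.HubbardSuperconductivity.Theorems.KLRegimeSplit

end
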